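import Mathlib
import Summits.AtomisticToContinuum.Crystallization.Theorems.ChargedEnergyGap.Negative.BlocksBound
import Literature.MathematicalPhysics.StatisticalMechanics.BarlowStacking
import Literature.Geometry.DiscreteGeometry.BondGraph
import Literature.MathematicalPhysics.StatisticalMechanics.HaggStacking

/-!
# Line `Sketch` of crux `PricedLinkCensus.StackingHinge` (stmt-AtomisticToContinuum-14993): the hcp stacking matches itself

Truth test of the `U`-column of the priced inequality `PricedHcpPeriodicAt a h` (Cruxes/StackingHinge/Lines/Sketch.lean): at a
point of the hcp periodic configuration `hcpPeriodicConfiguration ha hh` EVERY window is two-way matched, at every radius `R` and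
every tolerance `ε ≥ 0`, with the rigid image of `barlowStacking a h alternatingHagg` under the identity — so hcp itself has no
unmatched site (`U = ∅`, `natCard_unmatched_hcp_eq_zero`) and the priced inequality holds for `Q = hcp a h` with ANY `κ` and
any `C ≥ 0` (`priced_at_hcp`, by `e* ≤ e(hcp a h)`, tree `ChargedEnergyGapNegative.eStar_le`).  And the REDUCTION every proof of the
stub will start with: it suffices to price against `e(hcp a h)` instead of `e*` (`pricedHcpPeriodic_of_relative`).  All `[folklore]`.
-/

namespace Summit.AtomisticToContinuum.Crystallization.Theorems.PricedHcpWindowsSanity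

open Literature.MathematicalPhysics.StatisticalMechanics Literature.Geometry.DiscreteGeometry

/-- **The hcp stacking matches itself** (identity rigid motion): for every point `p` of a set `S ⊆ ℝ³`, every radius `R`
and tolerance `ε ≥ 0`, the `R`-window of `p` in `S` is two-way `ε`-matched with `S` itself — the rigid-motion matching format
of `stackingHinge_of_chargedPeriodicBarlowWord` with `g = refl`. [folklore] -/
theorem rigidMatch_self (S : Set (EuclideanSpace ℝ (Fin 3))) (R ε : ℝ) (hε : 0 ≤ ε) (p : S) :
    ∃ g : EuclideanSpace ℝ (Fin 3) ≃ᵃⁱ[ℝ] EuclideanSpace ℝ (Fin 3),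
      (∀ j : S, dist (p : EuclideanSpace ℝ (Fin 3)) j ≤ R → ∃ z ∈ S, dist (j : EuclideanSpace ℝ (Fin 3)) (g z) ≤ ε) ∧
      (∀ z ∈ S, dist (p : EuclideanSpace ℝ (Fin 3)) (g z) ≤ R → ∃ j : S, dist (j : EuclideanSpace ℝ (Fin 3)) (g z) ≤ ε) := by
  refine ⟨AffineIsometryEquiv.refl ℝ _, fun j _ => ⟨j, j.2, ?_⟩, fun z hz _ => ⟨⟨z, hz⟩, ?_⟩⟩
  · simpa using hε
  · simpa using hε

/-- Hence at every motif point of the hcp periodic configuration `hcpPeriodicConfiguration ha hh` the `R`-window, read in its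
point set, is two-way `ε`-matched (`ε ≥ 0`) with a rigid image of `barlowStacking a h alternatingHagg` — the `U`-set of the priced
inequality `PricedHcpPeriodicAt a h` of line `Sketch` is EMPTY for `Q = hcp a h` itself.  (Registered on the crux as the helper stub
`stub_hcpWindowMatched`.) [folklore] -/
theorem stub_hcpWindowMatched : ∀ (a h : ℝ) (ha : a ≠ 0) (hh : h ≠ 0) (R ε : ℝ), 0 ≤ ε → ∀ p : (Literature.MathematicalPhysics.StatisticalMechanics.hcpPeriodicConfiguration ha hh).points, ∃ g : EuclideanSpace ℝ (Fin 3) ≃ᵃⁱ[ℝ] EuclideanSpace ℝ (Fin 3), (∀ j : (Literature.MathematicalPhysics.StatisticalMechanics.hcpPeriodicConfiguration ha hh).points, dist (p : EuclideanSpace ℝ (Fin 3)) (j : EuclideanSpace ℝ (Fin 3)) ≤ R → ∃ z ∈ Literature.MathematicalPhysics.StatisticalMechanics.barlowStacking a h Literature.MathematicalPhysics.StatisticalMechanics.alternatingHagg, dist (j : EuclideanSpace ℝ (Fin 3)) (g z) ≤ ε) ∧ (∀ z ∈ Literature.MathematicalPhysics.StatisticalMechanics.barlowStacking a h Literature.MathematicalPhysics.StatisticalMechanics.alternatingHagg,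 dist (p : EuclideanSpace ℝ (Fin 3)) (g z) ≤ R → ∃ j : (Literature.MathematicalPhysics.StatisticalMechanics.hcpPeriodicConfiguration ha hh).points, dist (j : EuclideanSpace ℝ (Fin 3)) (g z) ≤ ε) := by
  intro a h ha hh R ε hε p
  have hpts : (hcpPeriodicConfiguration ha hh).points = barlowStacking a h alternatingHagg :=
    hcpPeriodicConfiguration_points ha hh
  refine ⟨AffineIsometryEquiv.refl ℝ _, fun j _ => ⟨j, hpts ▸ j.2, by simpa using hε⟩, fun z hz _ => ?_⟩
  exact ⟨⟨z, hpts ▸ hz⟩, by simpa using hε⟩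

/-- **`U = ∅` for hcp**: no motif point of `Q = hcpPeriodicConfiguration ha hh` is a "good but unmatched" site of the priced
inequality `PricedHcpPeriodicAt a h` (whatever `L`, `R`, and `ε ≥ 0`). [folklore] -/
theorem natCard_unmatched_hcp_eq_zero {a h : ℝ} (ha : a ≠ 0) (hh : h ≠ 0) (L R ε : ℝ) (hε : 0 ≤ ε) :
    Nat.card {x : (hcpPeriodicConfiguration ha hh).motif //
      (∀ j : (hcpPeriodicConfiguration ha hh).points,
        dist ((Subtype.val : (hcpPeriodicConfiguration ha hh).points → EuclideanSpace ℝ (Fin 3)) ⟨x.1, (hcpPeriodicConfiguration ha hh).mem_points_of_mem_motif x.2⟩)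
          ((Subtype.val : (hcpPeriodicConfiguration ha hh).points → EuclideanSpace ℝ (Fin 3)) j) ≤
          L * nearestDist (Subtype.val : (hcpPeriodicConfiguration ha hh).points → EuclideanSpace ℝ (Fin 3)) ⟨x.1, (hcpPeriodicConfiguration ha hh).mem_points_of_mem_motif x.2⟩ →
        IsChargeFree (1 / 100 : ℝ) (Subtype.val : (hcpPeriodicConfiguration ha hh).points → EuclideanSpace ℝ (Fin 3)) j) ∧
      ¬ ∃ g : EuclideanSpace ℝ (Fin 3) ≃ᵃⁱ[ℝ] EuclideanSpace ℝ (Fin 3),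
        (∀ j : (hcpPeriodicConfiguration ha hh).points,
          dist ((Subtype.val : (hcpPeriodicConfiguration ha hh).points → EuclideanSpace ℝ (Fin 3)) ⟨x.1, (hcpPeriodicConfiguration ha hh).mem_points_of_mem_motif x.2⟩)
            ((Subtype.val : (hcpPeriodicConfiguration ha hh).points → EuclideanSpace ℝ (Fin 3)) j) ≤ R →
          ∃ z ∈ barlowStacking a h alternatingHagg, dist ((Subtype.val : (hcpPeriodicConfiguration ha hh).points → EuclideanSpace ℝ (Fin 3)) j) (g z) ≤ ε) ∧
        (∀ z ∈ barlowStacking a h alternatingHagg, dist ((Subtype.val : (hcpPeriodicConfiguration ha hh).points → EuclideanSpace ℝ (Fin 3)) ⟨x.1, (hcpPeriodicConfiguration ha hh).mem_points_of_mem_motif x.2⟩) (g z) ≤ R →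
          ∃ j : (hcpPeriodicConfiguration ha hh).points, dist ((Subtype.val : (hcpPeriodicConfiguration ha hh).points → EuclideanSpace ℝ (Fin 3)) j) (g z) ≤ ε)} = 0 := by
  rw [Nat.card_eq_zero]
  left
  refine ⟨fun x => x.2.2 ?_⟩
  exact stub_hcpWindowMatched a h ha hh R ε hε ⟨x.1.1, (hcpPeriodicConfiguration ha hh).mem_points_of_mem_motif x.1.2⟩

/-- **The priced inequality holds at `Q = hcp a h` with any `κ` and any `C ≥ 0`**: the `U`-count vanishes and
`e* ≤ e(hcp a h)` (`ChargedEnergyGapNegative.eStar_le`). [folklore] -/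
theorem priced_at_hcp {a h : ℝ} (ha : a ≠ 0) (hh : h ≠ 0) (κ L R ε C : ℝ) (hε : 0 ≤ ε) (hC : 0 ≤ C) :
    let Q := hcpPeriodicConfiguration ha hh
    κ * (Nat.card {x : Q.motif // (∀ j : Q.points, dist ((Subtype.val : Q.points → EuclideanSpace ℝ (Fin 3)) ⟨x.1, Q.mem_points_of_mem_motif x.2⟩) ((Subtype.val : Q.points → EuclideanSpace ℝ (Fin 3)) j) ≤ L * nearestDist (Subtype.val : Q.points → EuclideanSpace ℝ (Fin 3)) ⟨x.1, Q.mem_points_of_mem_motif x.2⟩ → IsChargeFree (1 / 100 : ℝ) (Subtype.val : Q.points → EuclideanSpace ℝ (Fin 3)) j) ∧ ¬ ∃ g : EuclideanSpace ℝ (Fin 3) ≃ᵃⁱ[ℝ] EuclideanSpace ℝ (Fin 3), (∀ j : Q.points, dist ((Subtype.val : Q.points → EuclideanSpace ℝ (Fin 3)) ⟨x.1, Q.mem_points_of_mem_motif x.2⟩) ((Subtype.val : Q.points → EuclideanSpace ℝ (Fin 3)) j) ≤ R → ∃ z ∈ barlowStacking a h alternatingHagg, dist ((Subtype.val : Q.points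 → EuclideanSpace ℝ (Fin 3)) j) (g z) ≤ ε) ∧ (∀ z ∈ barlowStacking a h alternatingHagg, dist ((Subtype.val : Q.points → EuclideanSpace ℝ (Fin 3)) ⟨x.1, Q.mem_points_of_mem_motif x.2⟩) (g z) ≤ R → ∃ j : Q.points, dist ((Subtype.val : Q.points → EuclideanSpace ℝ (Fin 3)) j) (g z) ≤ ε)} : ℝ) - C * (Nat.card {x : Q.motif // ¬ ∀ j : Q.points, dist ((Subtype.val : Q.points → EuclideanSpace ℝ (Fin 3)) ⟨x.1, Q.mem_points_of_mem_motif x.2⟩) ((Subtype.val : Q.points → EuclideanSpace ℝ (Fin 3)) j) ≤ L * nearestDist (Subtype.val : Q.points → EuclideanSpace ℝ (Fin 3)) ⟨x.1, Q.mem_points_of_mem_motif x.2⟩ → IsChargeFree (1 / 100 : ℝ) (Subtype.val : Q.points → EuclideanSpace ℝ (Fin 3)) j} : ℝ) ≤ (Q.motif.card : ℝ) * (Q.energyPerParticle lennardJones - (⨅ Q : PeriodicConfiguration 3, Q.energyPerParticle lennardJones)) := by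
  intro Q
  have hU := natCard_unmatched_hcp_eq_zero ha hh L R ε hε
  have h0 : (Nat.card {x : Q.motif // (∀ j : Q.points, dist ((Subtype.val : Q.points → EuclideanSpace ℝ (Fin 3)) ⟨x.1, Q.mem_points_of_mem_motif x.2⟩) ((Subtype.val : Q.points → EuclideanSpace ℝ (Fin 3)) j) ≤ L * nearestDist (Subtype.val : Q.points → EuclideanSpace ℝ (Fin 3)) ⟨x.1, Q.mem_points_of_mem_motif x.2⟩ → IsChargeFree (1 / 100 : ℝ) (Subtype.val : Q.points → EuclideanSpace ℝ (Fin 3)) j) ∧ ¬ ∃ g : EuclideanSpace ℝ (Fin 3) ≃ᵃⁱ[ℝ] EuclideanSpace ℝ (Fin 3), (∀ j : Q.points, dist ((Subtype.val : Q.points → EuclideanSpace ℝ (Fin 3)) ⟨x.1, Q.mem_points_of_mem_motif x.2⟩) ((Subtype.val : Q.points → EuclideanSpace ℝ (Fin 3)) j) ≤ R → ∃ z ∈ barlowStacking a h alternatingHagg, dist ((Subtype.val : Q.points → EuclideanSpace ℝ (Fin 3)) j) (g z) ≤ ε) ∧ (∀ z ∈ barlowStacking a h alternatingHagg, dist ((Subtype.val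 : Q.points → EuclideanSpace ℝ (Fin 3)) ⟨x.1, Q.mem_points_of_mem_motif x.2⟩) (g z) ≤ R → ∃ j : Q.points, dist ((Subtype.val : Q.points → EuclideanSpace ℝ (Fin 3)) j) (g z) ≤ ε)} : ℝ) = 0 := by exact_mod_cast hU
  rw [h0, mul_zero, zero_sub]
  have h1 : (⨅ Q : PeriodicConfiguration 3, Q.energyPerParticle lennardJones) ≤ Q.energyPerParticle lennardJones :=
    Summit.AtomisticToContinuum.Crystallization.Theorems.ChargedEnergyGapNegative.eStar_le Q
  have h2 : (0 : ℝ) ≤ (Q.motif.card : ℝ) * (Q.energyPerParticle lennardJones - ⨅ Q : PeriodicConfiguration 3, Q.energyPerParticle lennardJones) :=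
    mul_nonneg (Nat.cast_nonneg _) (sub_nonneg.2 h1)
  have h3 : (0 : ℝ) ≤ C * (Nat.card {x : Q.motif // ¬ ∀ j : Q.points, dist ((Subtype.val : Q.points → EuclideanSpace ℝ (Fin 3)) ⟨x.1, Q.mem_points_of_mem_motif x.2⟩) ((Subtype.val : Q.points → EuclideanSpace ℝ (Fin 3)) j) ≤ L * nearestDist (Subtype.val : Q.points → EuclideanSpace ℝ (Fin 3)) ⟨x.1, Q.mem_points_of_mem_motif x.2⟩ → IsChargeFree (1 / 100 : ℝ) (Subtype.val : Q.points → EuclideanSpace ℝ (Fin 3)) j} : ℝ) := mul_nonneg hC (Nat.cast_nonneg _)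
  linarith

/-- **It suffices to price against `e(hcp a h)`.**  If every `δ₀`-separated periodic `Q` satisfies the priced inequality with
`e(hcpPeriodicConfiguration ha hh)` in place of the periodic infimum `e*` on the right, then it satisfies it with `e*`
(`e* ≤ e(hcp a h)`, `ChargedEnergyGapNegative.eStar_le`): the stub `stub_pricedHcpPeriodic` of line `Sketch` never needs to identify
`e*`. [folklore] -/
theorem pricedHcpPeriodic_of_relative : ∀ (a h : ℝ) (ha : a ≠ 0) (hh : h ≠ 0), (∀ δ₀ : ℝ, 0 < δ₀ → ∀ R ε : ℝ, 0 < R → 0 < ε → ∃ κ L C : ℝ, 0 < κ ∧ 0 < L ∧ ∀ Q : Literature.MathematicalPhysics.StatisticalMechanics.PeriodicConfiguration 3, (∀ p q : Q.points, p ≠ q → δ₀ ≤ dist (p : EuclideanSpace ℝ (Fin 3)) (q : EuclideanSpace ℝ (Fin 3))) → κ * (Nat.card {x : Q.motif // (∀ j : Q.points, dist ((Subtype.val : Q.points → EuclideanSpace ℝ (Fin 3)) ⟨x.1, Q.mem_points_of_mem_motif x.2⟩) ((Subtype.val : Q.points → EuclideanSpace ℝ (Fin 3)) j) ≤ L * Literature.Geometry.DiscreteGeometry.nearestDist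 (Subtype.val : Q.points → EuclideanSpace ℝ (Fin 3)) ⟨x.1, Q.mem_points_of_mem_motif x.2⟩ → Literature.Geometry.DiscreteGeometry.IsChargeFree (1 / 100 : ℝ) (Subtype.val : Q.points → EuclideanSpace ℝ (Fin 3)) j) ∧ ¬ ∃ g : EuclideanSpace ℝ (Fin 3) ≃ᵃⁱ[ℝ] EuclideanSpace ℝ (Fin 3), (∀ j : Q.points, dist ((Subtype.val : Q.points → EuclideanSpace ℝ (Fin 3)) ⟨x.1, Q.mem_points_of_mem_motif x.2⟩) ((Subtype.val : Q.points → EuclideanSpace ℝ (Fin 3)) j) ≤ R → ∃ z ∈ Literature.MathematicalPhysics.StatisticalMechanics.barlowStacking a h Literature.MathematicalPhysics.StatisticalMechanics.alternatingHagg, dist ((Subtype.val : Q.points → EuclideanSpace ℝ (Fin 3)) j) (g z) ≤ ε) ∧ (∀ z ∈ Literature.MathematicalPhysics.StatisticalMechanics.barlowStacking a h Literature.MathematicalPhysics.StatisticalMechanics.alternatingHagg, dist ((Subtype.val : Q.points → EuclideanSpace ℝ (Fin 3)) ⟨x.1, Q.mem_points_of_mem_motif x.2⟩) (g z) ≤ R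 → ∃ j : Q.points, dist ((Subtype.val : Q.points → EuclideanSpace ℝ (Fin 3)) j) (g z) ≤ ε)} : ℝ) - C * (Nat.card {x : Q.motif // ¬ ∀ j : Q.points, dist ((Subtype.val : Q.points → EuclideanSpace ℝ (Fin 3)) ⟨x.1, Q.mem_points_of_mem_motif x.2⟩) ((Subtype.val : Q.points → EuclideanSpace ℝ (Fin 3)) j) ≤ L * Literature.Geometry.DiscreteGeometry.nearestDist (Subtype.val : Q.points → EuclideanSpace ℝ (Fin 3)) ⟨x.1, Q.mem_points_of_mem_motif x.2⟩ → Literature.Geometry.DiscreteGeometry.IsChargeFree (1 / 100 : ℝ) (Subtype.val : Q.points → EuclideanSpace ℝ (Fin 3)) j} : ℝ) ≤ (Q.motif.card : ℝ) * (Q.energyPerParticle Literature.MathematicalPhysics.StatisticalMechanics.lennardJones - (Literature.MathematicalPhysics.StatisticalMechanics.hcpPeriodicConfiguration ha hh).energyPerParticle Literature.MathematicalPhysics.StatisticalMechanics.lennardJones)) → ∀ δ₀ : ℝ, 0 < δ₀ → ∀ R ε : ℝ, 0 < R → 0 < ε → ∃ κ L C : ℝ, 0 < κ ∧ 0 < L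 ∧ ∀ Q : Literature.MathematicalPhysics.StatisticalMechanics.PeriodicConfiguration 3, (∀ p q : Q.points, p ≠ q → δ₀ ≤ dist (p : EuclideanSpace ℝ (Fin 3)) (q : EuclideanSpace ℝ (Fin 3))) → κ * (Nat.card {x : Q.motif // (∀ j : Q.points, dist ((Subtype.val : Q.points → EuclideanSpace ℝ (Fin 3)) ⟨x.1, Q.mem_points_of_mem_motif x.2⟩) ((Subtype.val : Q.points → EuclideanSpace ℝ (Fin 3)) j) ≤ L * Literature.Geometry.DiscreteGeometry.nearestDist (Subtype.val : Q.points → EuclideanSpace ℝ (Fin 3)) ⟨x.1, Q.mem_points_of_mem_motif x.2⟩ → Literature.Geometry.DiscreteGeometry.IsChargeFree (1 / 100 : ℝ) (Subtype.val : Q.points → EuclideanSpace ℝ (Fin 3)) j) ∧ ¬ ∃ g : EuclideanSpace ℝ (Fin 3) ≃ᵃⁱ[ℝ] EuclideanSpace ℝ (Fin 3), (∀ j : Q.points, dist ((Subtype.val : Q.points → EuclideanSpace ℝ (Fin 3)) ⟨x.1, Q.mem_points_of_mem_motif x.2⟩) ((Subtype.val : Q.points → EuclideanSpace ℝ (Fin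 3)) j) ≤ R → ∃ z ∈ Literature.MathematicalPhysics.StatisticalMechanics.barlowStacking a h Literature.MathematicalPhysics.StatisticalMechanics.alternatingHagg, dist ((Subtype.val : Q.points → EuclideanSpace ℝ (Fin 3)) j) (g z) ≤ ε) ∧ (∀ z ∈ Literature.MathematicalPhysics.StatisticalMechanics.barlowStacking a h Literature.MathematicalPhysics.StatisticalMechanics.alternatingHagg, dist ((Subtype.val : Q.points → EuclideanSpace ℝ (Fin 3)) ⟨x.1, Q.mem_points_of_mem_motif x.2⟩) (g z) ≤ R → ∃ j : Q.points, dist ((Subtype.val : Q.points → EuclideanSpace ℝ (Fin 3)) j) (g z) ≤ ε)} : ℝ) - C * (Nat.card {x : Q.motif // ¬ ∀ j : Q.points, dist ((Subtype.val : Q.points → EuclideanSpace ℝ (Fin 3)) ⟨x.1, Q.mem_points_of_mem_motif x.2⟩) ((Subtype.val : Q.points → EuclideanSpace ℝ (Fin 3)) j) ≤ L * Literature.Geometry.DiscreteGeometry.nearestDist (Subtype.val : Q.points → EuclideanSpace ℝ (Fin 3)) ⟨x.1, Q.mem_points_of_mem_motif x.2⟩ → Literature.Geometry.DiscreteGeometry.IsChargeFree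 (1 / 100 : ℝ) (Subtype.val : Q.points → EuclideanSpace ℝ (Fin 3)) j} : ℝ) ≤ (Q.motif.card : ℝ) * (Q.energyPerParticle Literature.MathematicalPhysics.StatisticalMechanics.lennardJones - (⨅ Q : Literature.MathematicalPhysics.StatisticalMechanics.PeriodicConfiguration 3, Q.energyPerParticle Literature.MathematicalPhysics.StatisticalMechanics.lennardJones)) := by
  intro a h ha hh H δ₀ hδ₀ R ε hR hε
  obtain ⟨κ, L, C, hκ, hL, hall⟩ := H δ₀ hδ₀ R ε hR hε
  refine ⟨κ, L, C, hκ, hL, fun Q hQ => (hall Q hQ).trans ?_⟩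
  have h1 : (⨅ Q : PeriodicConfiguration 3, Q.energyPerParticle lennardJones) ≤
      (hcpPeriodicConfiguration ha hh).energyPerParticle lennardJones :=
    Summit.AtomisticToContinuum.Crystallization.Theorems.ChargedEnergyGapNegative.eStar_le _
  exact mul_le_mul_of_nonneg_left (by linarith) (Nat.cast_nonneg _)

end Summit.AtomisticToContinuum.Crystallization.Theorems.PricedHcpWindowsSanity
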